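import Mathlib
import Summits.Ventures.HodgeRepro2.T5LocalRingGaussSum

/-!
# T5PrimitiveAddChar — a primitive additive character is one whose kernel contains no non-zero ideal;
on a finite local ring it is non-trivial on the socle `Ann(𝔪)`

Kernel support for Tier 5, sub-step N5 / §G, reading residual [R-4] (route/T5-CHECK-G-p7.md §4; the sentence
«a non-zero ideal is never inside `ker ψ` when `ψ` is primitive» of route/LEAN-ANNEX-p7.md §2q). Mathlib's
`AddChar.IsPrimitive ψ` says that every multiplicative shift `ψ(a·)`, `a ≠ 0`, is non-trivial. We record the
ideal-theoretic reading used by `T5LocalRingGaussSum` and `T5DVRQuotientModel`: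

* `isPrimitive_iff_forall_ideal`: `ψ` is primitive iff every non-zero ideal `I` carries some `x` with `ψ x ≠ 1`
  («`ker ψ` contains no non-zero ideal»; any commutative ring);
* `exists_ne_zero_killsNonunits`: a non-trivial finite local ring has a non-zero socle `Ann(𝔪)` (the maximal
  ideal is nilpotent — `IsArtinianRing.isNilpotent_jacobson_bot`);
* `exists_killsNonunits_ne_one_of_isPrimitive`: a primitive character of a non-trivial finite local ring is
  non-trivial on the socle `{c ∣ KillsNonunits c}`. (The converse holds for chain rings such as `𝒪/𝔭^n`,
  where the socle is the unique minimal ideal — `T5DVRQuotientModel.isPrimitive_iff_socle`; it fails in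
  general, e.g. for `k[x,y]/(x,y)²`, whose socle `(x,y)/(x,y)²` has non-zero proper sub-ideals.)
-/

namespace Summit.Ventures.HodgeRepro2.T5PrimitiveAddChar

open Summit.Ventures.HodgeRepro2.T5LocalRingGaussSum

variable {R : Type*} [CommRing R] {M : Type*} [CommMonoid M]

/-- A primitive character is non-trivial on every non-zero ideal. -/
theorem exists_mem_ne_one_of_isPrimitive {ψ : AddChar R M} (hψ : ψ.IsPrimitive) {I : Ideal R}
    (hI : I ≠ ⊥) : ∃ x ∈ I, ψ x ≠ 1 := by
  obtain ⟨a, haI, ha⟩ := Submodule.exists_mem_ne_zero_of_ne_bot hI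
  obtain ⟨z, hz⟩ := AddChar.ne_one_iff.1 (hψ ha)
  rw [AddChar.mulShift_apply] at hz
  exact ⟨a * z, I.mul_mem_right z haI, hz⟩

/-- A character non-trivial on every non-zero ideal is primitive. -/
theorem isPrimitive_of_forall_ideal {ψ : AddChar R M}
    (h : ∀ I : Ideal R, I ≠ ⊥ → ∃ x ∈ I, ψ x ≠ 1) : ψ.IsPrimitive := by
  intro a ha
  obtain ⟨x, hx, hψx⟩ := h (Ideal.span {a}) (by
    rw [Ne, Ideal.span_singleton_eq_bot]
    exact ha)
  obtain ⟨z, rfl⟩ := Ideal.mem_span_singleton'.1 hx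
  rw [AddChar.ne_one_iff]
  refine ⟨z, ?_⟩
  rwa [AddChar.mulShift_apply, mul_comm]

/-- **Primitive ⟺ the kernel contains no non-zero ideal.** -/
theorem isPrimitive_iff_forall_ideal {ψ : AddChar R M} :
    ψ.IsPrimitive ↔ ∀ I : Ideal R, I ≠ ⊥ → ∃ x ∈ I, ψ x ≠ 1 :=
  ⟨fun hψ _ hI => exists_mem_ne_one_of_isPrimitive hψ hI, isPrimitive_of_forall_ideal⟩

/-- Unfolded form: `ψ` is primitive iff for every `a ≠ 0` some multiple `a * z` has `ψ (a * z) ≠ 1`. -/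
theorem isPrimitive_iff_forall_ne_zero {ψ : AddChar R M} :
    ψ.IsPrimitive ↔ ∀ a : R, a ≠ 0 → ∃ z : R, ψ (a * z) ≠ 1 := by
  simp only [AddChar.IsPrimitive, AddChar.ne_one_iff, AddChar.mulShift_apply]

/-! ### The socle of a finite local ring is non-zero -/

/-- `0` kills the non-units. -/
theorem killsNonunits_zero : KillsNonunits (0 : R) := fun _ _ => mul_zero _

section LocalRing

variable [IsLocalRing R]

/-- In a finite local ring the maximal ideal is nilpotent. -/
theorem exists_maximalIdeal_pow_eq_bot [Finite R] :
    ∃ n : ℕ, IsLocalRing.maximalIdeal R ^ n = ⊥ := by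
  haveI : IsArtinianRing R := isArtinian_of_finite
  obtain ⟨n, hn⟩ := IsArtinianRing.isNilpotent_jacobson_bot (R := R)
  refine ⟨n, ?_⟩
  rwa [IsLocalRing.jacobson_eq_maximalIdeal ⊥ bot_ne_top, Ideal.zero_eq_bot] at hn

/-- **The socle is non-zero.** A non-trivial finite local ring has a non-zero element killing the
maximal ideal: if `𝔪^n = 0` with `n` minimal, any non-zero element of `𝔪^{n-1}` does. -/
theorem exists_ne_zero_killsNonunits [Finite R] :
    ∃ c : R, c ≠ 0 ∧ KillsNonunits c := by
  classical
  have hex := exists_maximalIdeal_pow_eq_bot (R := R)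
  have hn : IsLocalRing.maximalIdeal R ^ Nat.find hex = ⊥ := Nat.find_spec hex
  have hn0 : Nat.find hex ≠ 0 := by
    intro h0
    rw [h0, pow_zero, Ideal.one_eq_top] at hn
    exact top_ne_bot hn
  obtain ⟨k, hk⟩ := Nat.exists_eq_add_one_of_ne_zero hn0
  have hk' : IsLocalRing.maximalIdeal R ^ k ≠ ⊥ := Nat.find_min hex (by omega)
  rw [hk] at hn
  obtain ⟨c, hc, hc0⟩ := Submodule.exists_mem_ne_zero_of_ne_bot hk'
  refine ⟨c, hc0, fun y hy => ?_⟩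
  have hy' : y ∈ IsLocalRing.maximalIdeal R := (not_isUnit_iff_mem_maximalIdeal y).1 hy
  have : y * c ∈ IsLocalRing.maximalIdeal R ^ (k + 1) := by
    rw [pow_succ']
    exact Ideal.mul_mem_mul hy' hc
  rw [hn] at this
  exact (Submodule.mem_bot R).1 this

/-- A primitive character of a non-trivial finite local ring is non-trivial on the socle. -/
theorem exists_killsNonunits_ne_one_of_isPrimitive [Finite R] {ψ : AddChar R M}
    (hψ : ψ.IsPrimitive) : ∃ x : R, KillsNonunits x ∧ ψ x ≠ 1 := by
  obtain ⟨c, hc0, hc⟩ := exists_ne_zero_killsNonunits (R := R)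
  have hI : (IsLocalRing.maximalIdeal R).annihilator ≠ ⊥ := by
    intro h
    have hc' : c ∈ (IsLocalRing.maximalIdeal R).annihilator :=
      (killsNonunits_iff_mem_annihilator c).1 hc
    rw [h, Submodule.mem_bot] at hc'
    exact hc0 hc'
  obtain ⟨x, hx, hψx⟩ := exists_mem_ne_one_of_isPrimitive hψ hI
  exact ⟨x, (killsNonunits_iff_mem_annihilator x).2 hx, hψx⟩

end LocalRing

end Summit.Ventures.HodgeRepro2.T5PrimitiveAddChar
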